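import Literature.AnabelianGeometry.EtaleTheta.FrobenioidMonoThetaEnv
import Literature.AnabelianGeometry.EtaleTheta.Discharge.Sec5UnitsTransport
import Mathlib.Tactic.Group

/-!
# [EtTh] §5, Theorem 5.10 (iii): automorphisms of `E^Π_N` induced from its two factors (pp. 334–335 / PDF pp. 108–109)

Mochizuki, *The étale theta function …*, Publ. RIMS **45** (2009)
[cite: MochizukiEtTh2009, Thm 5.10 (iii) p.334 (PDF p.108)].  Seat abc-iut-L2-d4 (wave-3 discharge of node
`EtTh:Thm5.10(iii)`), over abc-iut-L2-t4's §5 data `ThetaFrobenioid` and the Frobenioid-theoretic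
mono-theta environment `frdMonoThetaEnv` (`FrobenioidMonoThetaEnv.lean`).  This file holds the
DEFINITIONS; the discharge theorems are in `Discharge/Sec5Thm510iii.lean`.

The proof of Theorem 5.10 (iii) (p.335 (PDF p.109)) produces an automorphism `γ` of the topological group
`E^Π_N = E_N ×_{Im(Π^tp_Y̲)} Π^tp_Y̲ ⊆ Aut_C(B_N) × Π^tp_X̲` and an inner automorphism `κ` of `Aut_C(B_N)` with
`Ψ^Aut ∘ ϵ = κ ∘ ϵ ∘ γ`.  Here:
* `ambientAut Φ ψ`, `envAut`: a pair of automorphisms `Φ` of `Aut_C(B_N)` and `ψ` of `Π^tp_X̲` that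
  stabilises `E^Π_N` induces a bi-continuous automorphism of `E^Π_N` ("an automorphism of topological
  groups", p.334 (PDF p.108); for the "evident topology" of p.332 (PDF p.106), `Aut_C(B_N)` discrete, continuity is automatic);
* `transport_envAut_conjOut`: on `Out(E^Π_N)` it transports "conjugation by `n`" to "conjugation by
  `(Φ, ψ)(n)`" — the bookkeeping behind "`γ` determines an automorphism of mono-theta environments";
* `IsEnvCompatible Φ ψ`: the conditions extracted from Theorem 5.10 (ii) (after composing `Ψ^Aut` with
  `κ⁻¹`, `κ = Inn(δ₁ · δ₂ · δ₃)`) and from the compatibility of `ψ` with `Ψ^bs` (Thm. 4.4 (i)) under which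
  `(Φ, ψ)` stabilises `E^Π_N`: `Φ(E_N) = E_N`, `Φ(O^×(B_N)) = O^×(B_N)`, `Φ(Im s^⊔-gp_N) = Im s^⊔-gp_N`,
  `(Φ(s^⊓-gp_N(ρ g)))^bs = ρ(ψ g)`, `ψ(Π^tp_Y̲) = Π^tp_Y̲`, `ψ(Π^tp_Ÿ̲) = Π^tp_Ÿ̲`;
* `conjTop`, `psiAutEquiv`: `Inn(g)` on `Π^tp_X̲` and `Ψ^Aut` as automorphisms.
HONEST FRAMING: nothing here asserts a result of [EtTh]; the theorems are kernel-checked statements about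
the typed §5 data, modulo the named hypotheses they list; typed ≠ discharged; no side is taken on any
disputed claim downstream.
-/

namespace Literature.AnabelianGeometry.EtaleTheta

open CategoryTheory
open scoped Pointwise

universe w v v' u u'

namespace ThetaFrobenioid

variable {C : Type u} [Category.{v} C] {D : Type u'} [Category.{v'} D] (𝔉 : ThetaFrobenioid.{w} C D)

/-! ### Automorphisms of `E^Π_N` induced from `Aut_C(B_N) × Π^tp_X̲` -/

section ProdAut

variable (Φ : Aut 𝔉.BN ≃* Aut 𝔉.BN) (ψ : 𝔉.PiX ≃ₜ* 𝔉.PiX)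

/-- The automorphism `(Φ, ψ)` of the ambient group `Aut_C(B_N) × Π^tp_X̲` of `E^Π_N` (proof of
Thm. 5.10 (iii), p.335 (PDF p.109): `Ψ^Aut` followed by an inner automorphism on the first factor, an
automorphism of `Π^tp_X` "induced by `Ψ^bs`" on the second).
[cite: MochizukiEtTh2009, Thm 5.10 (iii) p.335 (PDF p.109)] -/
def ambientAut : (Aut 𝔉.BN × 𝔉.PiX) ≃* (Aut 𝔉.BN × 𝔉.PiX) :=
  MulEquiv.prodCongr Φ ψ.toMulEquiv

/-- Components of `ambientAut`. [cite: MochizukiEtTh2009, Thm 5.10 (iii) p.335 (PDF p.109)] -/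
@[simp] theorem ambientAut_apply (x : Aut 𝔉.BN × 𝔉.PiX) :
    𝔉.ambientAut Φ ψ x = (Φ x.1, ψ x.2) := rfl

/-- Components of the inverse of `ambientAut`. [cite: MochizukiEtTh2009, Thm 5.10 (iii) p.335 (PDF p.109)] -/
@[simp] theorem ambientAut_symm_apply (x : Aut 𝔉.BN × 𝔉.PiX) :
    (𝔉.ambientAut Φ ψ).symm x = (Φ.symm x.1, ψ.symm x.2) := rfl

/-- `(Φ, ψ)` stabilises the subgroup `E^Π_N ⊆ Aut_C(B_N) × Π^tp_X̲`.
[cite: MochizukiEtTh2009, Thm 5.10 (iii) p.335 (PDF p.109)] -/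
def StabilizesEPiN : Prop := ∀ x : Aut 𝔉.BN × 𝔉.PiX, x ∈ 𝔉.EPiN ↔ 𝔉.ambientAut Φ ψ x ∈ 𝔉.EPiN

variable {𝔉 Φ ψ}

/-- A stabilising pair has stabilising inverse. [cite: MochizukiEtTh2009, Thm 5.10 (iii) p.335 (PDF p.109)] -/
theorem StabilizesEPiN.symm (h : 𝔉.StabilizesEPiN Φ ψ) : 𝔉.StabilizesEPiN Φ.symm ψ.symm := by
  intro x
  change x ∈ 𝔉.EPiN ↔ (Φ.symm x.1, ψ.symm x.2) ∈ 𝔉.EPiN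
  rw [h (Φ.symm x.1, ψ.symm x.2)]
  simp

/-- Under a stabilising pair, `(Φ, ψ)(E^Π_N) = E^Π_N`. [cite: MochizukiEtTh2009, Thm 5.10 (iii) p.335 (PDF p.109)] -/
theorem StabilizesEPiN.map_eq (h : 𝔉.StabilizesEPiN Φ ψ) :
    𝔉.EPiN.map (𝔉.ambientAut Φ ψ).toMonoidHom = 𝔉.EPiN := by
  ext x
  constructor
  · rintro ⟨y, hy, rfl⟩
    exact (h y).mp hy
  · intro hx
    exact ⟨(𝔉.ambientAut Φ ψ).symm x, (h.symm x).mp hx, by simp⟩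

/-- `(Φ, ψ)` maps the normaliser of `E^Π_N` into itself.
[cite: MochizukiEtTh2009, Thm 5.10 (iii) p.335 (PDF p.109)] -/
theorem StabilizesEPiN.mem_normalizer (h : 𝔉.StabilizesEPiN Φ ψ) {n : Aut 𝔉.BN × 𝔉.PiX}
    (hn : n ∈ Subgroup.normalizer (𝔉.EPiN : Set (Aut 𝔉.BN × 𝔉.PiX))) :
    𝔉.ambientAut Φ ψ n ∈ Subgroup.normalizer (𝔉.EPiN : Set (Aut 𝔉.BN × 𝔉.PiX)) := by
  rw [Subgroup.mem_normalizer_iff] at hn ⊢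
  intro x
  have key : 𝔉.ambientAut Φ ψ n * x * (𝔉.ambientAut Φ ψ n)⁻¹ =
      𝔉.ambientAut Φ ψ (n * (𝔉.ambientAut Φ ψ).symm x * n⁻¹) := by
    rw [map_mul, map_mul, map_inv, MulEquiv.apply_symm_apply]
  rw [key, ← h, ← hn, h.symm x]
  rfl

variable (𝔉) in
/-- The automorphism of the abstract group `E^Π_N` induced by a stabilising pair `(Φ, ψ)`.
[cite: MochizukiEtTh2009, Thm 5.10 (iii) p.335 (PDF p.109)] -/
def envMulEquiv (h : 𝔉.StabilizesEPiN Φ ψ) : 𝔉.EPiN ≃* 𝔉.EPiN where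
  toFun x := ⟨𝔉.ambientAut Φ ψ x, (h x).mp x.2⟩
  invFun x := ⟨(𝔉.ambientAut Φ ψ).symm x, (h.symm x).mp x.2⟩
  left_inv x := Subtype.ext ((𝔉.ambientAut Φ ψ).symm_apply_apply x)
  right_inv x := Subtype.ext ((𝔉.ambientAut Φ ψ).apply_symm_apply x)
  map_mul' x y := Subtype.ext (map_mul (𝔉.ambientAut Φ ψ) (x : Aut 𝔉.BN × 𝔉.PiX) (y : Aut 𝔉.BN × 𝔉.PiX))

/-- Underlying pair of `envMulEquiv h x`. [cite: MochizukiEtTh2009, Thm 5.10 (iii) p.335 (PDF p.109)] -/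
@[simp] theorem coe_envMulEquiv (h : 𝔉.StabilizesEPiN Φ ψ) (x : 𝔉.EPiN) :
    ((𝔉.envMulEquiv h x : 𝔉.EPiN) : Aut 𝔉.BN × 𝔉.PiX) = (Φ x.1.1, ψ x.1.2) := rfl

/-- Underlying pair of the inverse. [cite: MochizukiEtTh2009, Thm 5.10 (iii) p.335 (PDF p.109)] -/
@[simp] theorem coe_envMulEquiv_symm (h : 𝔉.StabilizesEPiN Φ ψ) (x : 𝔉.EPiN) :
    (((𝔉.envMulEquiv h).symm x : 𝔉.EPiN) : Aut 𝔉.BN × 𝔉.PiX) = (Φ.symm x.1.1, ψ.symm x.1.2) := rfl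

/-- A map `E^Π_N → E^Π_N` that is componentwise `(f, g)` with `g` continuous is continuous for the
"evident topology" (`Aut_C(B_N)` discrete).  [cite: MochizukiEtTh2009, Lem 5.9 (iv) p.332 (PDF p.106)] -/
theorem continuous_of_componentwise (F : 𝔉.EPiN → 𝔉.EPiN) (f : Aut 𝔉.BN → Aut 𝔉.BN)
    (g : 𝔉.PiX → 𝔉.PiX) (hg : Continuous g)
    (hF : ∀ x : 𝔉.EPiN, ((F x : 𝔉.EPiN) : Aut 𝔉.BN × 𝔉.PiX) = (f x.1.1, g x.1.2)) :
    Continuous F := by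
  letI : TopologicalSpace (Aut 𝔉.BN) := 𝔉.autDiscrete
  haveI : DiscreteTopology (Aut 𝔉.BN) := ⟨rfl⟩
  letI : TopologicalSpace (Aut 𝔉.BN × 𝔉.PiX) := 𝔉.ambientTopology
  apply continuous_induced_rng.2
  change Continuous fun x : 𝔉.EPiN => ((F x : 𝔉.EPiN) : Aut 𝔉.BN × 𝔉.PiX)
  have : (fun x : 𝔉.EPiN => ((F x : 𝔉.EPiN) : Aut 𝔉.BN × 𝔉.PiX)) =
      (fun p : Aut 𝔉.BN × 𝔉.PiX => (f p.1, g p.2)) ∘ fun x : 𝔉.EPiN => (x : Aut 𝔉.BN × 𝔉.PiX) := by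
    funext x; exact hF x
  rw [this]
  exact (((continuous_of_discreteTopology (f := f)).comp continuous_fst).prodMk
    (hg.comp continuous_snd)).comp continuous_induced_dom

variable (𝔉) in
/-- **The automorphism of the topological group `E^Π_N`** induced by a stabilising pair `(Φ, ψ)`
(the `γ` of Thm. 5.10 (iii) is of this form).  [cite: MochizukiEtTh2009, Thm 5.10 (iii) p.334 (PDF p.108)] -/
def envAut (h : 𝔉.StabilizesEPiN Φ ψ) : 𝔉.EPiN ≃ₜ* 𝔉.EPiN :=
  { 𝔉.envMulEquiv h with
    continuous_toFun := continuous_of_componentwise _ Φ ψ ψ.continuous (coe_envMulEquiv h)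
    continuous_invFun :=
      continuous_of_componentwise _ Φ.symm ψ.symm ψ.symm.continuous (coe_envMulEquiv_symm h) }

/-- Underlying pair of `envAut h x`. [cite: MochizukiEtTh2009, Thm 5.10 (iii) p.335 (PDF p.109)] -/
@[simp] theorem coe_envAut (h : 𝔉.StabilizesEPiN Φ ψ) (x : 𝔉.EPiN) :
    ((𝔉.envAut h x : 𝔉.EPiN) : Aut 𝔉.BN × 𝔉.PiX) = (Φ x.1.1, ψ x.1.2) := rfl

/-- `ϵ ∘ γ = Φ ∘ ϵ`. [cite: MochizukiEtTh2009, Thm 5.10 (iii) p.334 (PDF p.108)] -/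
theorem epsilon_envAut (h : 𝔉.StabilizesEPiN Φ ψ) (x : 𝔉.EPiN) :
    𝔉.epsilon (𝔉.envAut h x) = Φ (𝔉.epsilon x) := rfl

/-- `γ` lies over `ψ` on `Π^tp_Y̲`. [cite: MochizukiEtTh2009, Thm 5.10 (iii) p.334 (PDF p.108)] -/
theorem toPiY_envAut (h : 𝔉.StabilizesEPiN Φ ψ) (x : 𝔉.EPiN) :
    𝔉.toPiY (𝔉.envAut h x) = ψ (𝔉.toPiY x) := rfl

/-- Transport along `γ = (Φ, ψ)|_{E^Π_N}` of the outer automorphism "conjugation by `n`" is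
"conjugation by `(Φ, ψ)(n)`".  [cite: MochizukiEtTh2009, Thm 5.10 (iii) p.334 (PDF p.108)] -/
theorem transport_envAut_conjOut (h : 𝔉.StabilizesEPiN Φ ψ)
    (n : Subgroup.normalizer (𝔉.EPiN : Set (Aut 𝔉.BN × 𝔉.PiX))) :
    TopOut.transport (𝔉.envAut h) (𝔉.conjOut n) =
      𝔉.conjOut ⟨𝔉.ambientAut Φ ψ n, h.mem_normalizer n.2⟩ := by
  change (QuotientGroup.mk' _) (conjContAut (𝔉.envAut h) _) = (QuotientGroup.mk' _) _
  congr 1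
  apply Subtype.ext
  apply MulEquiv.ext
  intro x
  apply Subtype.ext
  change 𝔉.ambientAut Φ ψ ((n : Aut 𝔉.BN × 𝔉.PiX) * (𝔉.ambientAut Φ ψ).symm x *
      (n : Aut 𝔉.BN × 𝔉.PiX)⁻¹) = 𝔉.ambientAut Φ ψ n * x * (𝔉.ambientAut Φ ψ n)⁻¹
  rw [map_mul, map_mul, map_inv, MulEquiv.apply_symm_apply]

end ProdAut

/-! ### Compatible pairs `(Φ, ψ)` (the hypotheses of the construction, from Thm. 5.10 (ii) and Thm. 4.4 (i)) -/

section Compatible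

variable (Φ : Aut 𝔉.BN ≃* Aut 𝔉.BN) (ψ : 𝔉.PiX ≃ₜ* 𝔉.PiX)

/-- **The compatibility of a pair `(Φ, ψ)`** — `Φ` an automorphism of `Aut_C(B_N)` (in Thm. 5.10 (iii):
`κ⁻¹ ∘ Ψ^Aut` with `κ` the inner automorphism by the `δ₁ · δ₂ · δ₃` of Thm. 5.10 (ii)), `ψ` an
automorphism of `Π^tp_X̲` (a representative of "the `Π^tp_X`-conjugacy class of automorphisms of `Π^tp_Y`
induced by `Ψ^bs` [cf. Theorem 4.4]", p.334 (PDF p.108)) — with the §5 data: the consequences of Theorem 5.10 (ii)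
"`Ψ^Aut` … preserve[s] `O^×(B_N)` … and map[s] the data `E_N`, `Im(s^⊔-gp_N)` to `δ₁ · E_N · δ₁⁻¹`,
`δ₁ · δ₂ · δ₃ · Im(s^⊔-gp_N) · δ₃⁻¹ · δ₂⁻¹ · δ₁⁻¹`" (p.334 (PDF p.108)) once `κ⁻¹` is applied, and the base
compatibility `(Φ(s^⊓-gp_N(ρ g)))^bs = ρ(ψ g)` expressing that `ψ` lies over the self-equivalence
`Ψ^bs` of `D` through the outer homomorphism `ρ : Π^tp_X ↠ Aut_D(B_N^bs)` (Def. 4.1 (ii)), together with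
`ψ(Π^tp_Y̲) = Π^tp_Y̲`, `ψ(Π^tp_Ÿ̲) = Π^tp_Ÿ̲` (Prop. 2.4: the coverings are preserved).
[cite: MochizukiEtTh2009, Thm 5.10 (iii) p.334–335 (PDF pp.108–109)] -/
structure IsEnvCompatible : Prop where
  /-- `Φ(E_N) = E_N` -/
  map_EN : 𝔉.EN.map Φ.toMonoidHom = 𝔉.EN
  /-- `Φ(O^×(B_N)) = O^×(B_N)` -/
  map_units : (𝔉.units 𝔉.BN).map Φ.toMonoidHom = 𝔉.units 𝔉.BN
  /-- `Φ(Im(s^⊔-gp_N)) = Im(s^⊔-gp_N)` -/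
  map_sgpCup : 𝔉.sgpCup.range.map Φ.toMonoidHom = 𝔉.sgpCup.range
  /-- `(Φ(s^⊓-gp_N(ρ g)))^bs = ρ(ψ g)` for `g ∈ Π^tp_X̲` -/
  base : ∀ g : 𝔉.PiX, 𝔉.autBase 𝔉.BN (Φ (𝔉.sgpCap (𝔉.ρ g))) = 𝔉.ρ (ψ g)
  /-- `ψ(Π^tp_Y̲) = Π^tp_Y̲` -/
  map_PiY : 𝔉.PiY.map ψ.toMulEquiv.toMonoidHom = 𝔉.PiY
  /-- `ψ(Π^tp_Ÿ̲) = Π^tp_Ÿ̲` -/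
  map_PiYdd : 𝔉.PiYdd.map ψ.toMulEquiv.toMonoidHom = 𝔉.PiYdd

variable {𝔉 Φ ψ}

namespace IsEnvCompatible

variable (hc : 𝔉.IsEnvCompatible Φ ψ)
include hc

/-- `Φ` covers `ψ` on all of `E^Π_N`-type pairs: if `e^bs = ρ(y)` then `Φ(e)^bs = ρ(ψ y)` (write
`e = u · s^⊓-gp_N(ρ y)` with `u ∈ O^×(B_N) = Ker`).  [cite: MochizukiEtTh2009, Thm 5.10 (iii) p.335 (PDF p.109)] -/
theorem autBase_apply (hsec : 𝔉.SgpCapSection) {e : Aut 𝔉.BN} {y : 𝔉.PiX}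
    (hey : 𝔉.autBase 𝔉.BN e = 𝔉.ρ y) : 𝔉.autBase 𝔉.BN (Φ e) = 𝔉.ρ (ψ y) := by
  have hu : e * (𝔉.sgpCap (𝔉.ρ y))⁻¹ ∈ 𝔉.units 𝔉.BN := by
    rw [𝔉.units_eq_ker, MonoidHom.mem_ker, map_mul, map_inv, hey, hsec, mul_inv_cancel]
  have hΦu : Φ (e * (𝔉.sgpCap (𝔉.ρ y))⁻¹) ∈ 𝔉.units 𝔉.BN :=
    (mem_iff_of_map_equiv_eq hc.map_units _).mpr hu
  rw [𝔉.units_eq_ker, MonoidHom.mem_ker, map_mul, map_inv, map_mul, map_inv,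
    mul_inv_eq_one, hc.base] at hΦu
  exact hΦu

/-- The inverse pair `(Φ⁻¹, ψ⁻¹)` is again compatible. [cite: MochizukiEtTh2009, Thm 5.10 (iii) p.335 (PDF p.109)] -/
theorem symm (hsec : 𝔉.SgpCapSection) : 𝔉.IsEnvCompatible Φ.symm ψ.symm where
  map_EN := map_symm_eq_of_map_equiv_eq hc.map_EN
  map_units := map_symm_eq_of_map_equiv_eq hc.map_units
  map_sgpCup := map_symm_eq_of_map_equiv_eq hc.map_sgpCup
  base g := by
    -- `Φ(s(ρ(ψ⁻¹ g)))^bs = ρ g = s(ρ g)^bs`, so the quotient lies in `O^× = Φ(O^×)`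
    have h1 : 𝔉.autBase 𝔉.BN (Φ (𝔉.sgpCap (𝔉.ρ (ψ.symm g)))) = 𝔉.ρ g := by
      rw [hc.base, ContinuousMulEquiv.apply_symm_apply]
    have hu : Φ (𝔉.sgpCap (𝔉.ρ (ψ.symm g))) * (𝔉.sgpCap (𝔉.ρ g))⁻¹ ∈ 𝔉.units 𝔉.BN := by
      rw [𝔉.units_eq_ker, MonoidHom.mem_ker, map_mul, map_inv, h1, hsec, mul_inv_cancel]
    have hu' : Φ.symm (Φ (𝔉.sgpCap (𝔉.ρ (ψ.symm g))) * (𝔉.sgpCap (𝔉.ρ g))⁻¹) ∈ 𝔉.units 𝔉.BN :=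
      (mem_iff_of_map_equiv_eq (map_symm_eq_of_map_equiv_eq hc.map_units) _).mpr hu
    rw [map_mul, map_inv, MulEquiv.symm_apply_apply, 𝔉.units_eq_ker, MonoidHom.mem_ker, map_mul,
      map_inv, hsec, mul_inv_eq_iff_eq_mul, one_mul] at hu'
    exact hu'.symm
  map_PiY := map_symm_eq_of_map_equiv_eq (Φ := ψ.toMulEquiv) hc.map_PiY
  map_PiYdd := map_symm_eq_of_map_equiv_eq (Φ := ψ.toMulEquiv) hc.map_PiYdd

/-- One direction of stability: `(Φ, ψ)(E^Π_N) ⊆ E^Π_N`. [cite: MochizukiEtTh2009, Thm 5.10 (iii) p.335 (PDF p.109)] -/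
theorem ambientAut_mem (hsec : 𝔉.SgpCapSection) {x : Aut 𝔉.BN × 𝔉.PiX} (hx : x ∈ 𝔉.EPiN) :
    𝔉.ambientAut Φ ψ x ∈ 𝔉.EPiN := by
  obtain ⟨he, hy, hc'⟩ := hx
  refine ⟨(mem_iff_of_map_equiv_eq hc.map_EN _).mpr he, ?_, hc.autBase_apply hsec hc'⟩
  exact (mem_iff_of_map_equiv_eq (Φ := ψ.toMulEquiv) hc.map_PiY _).mpr hy

/-- **A compatible pair stabilises `E^Π_N`.** [cite: MochizukiEtTh2009, Thm 5.10 (iii) p.335 (PDF p.109)] -/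
theorem stabilizesEPiN (hsec : 𝔉.SgpCapSection) : 𝔉.StabilizesEPiN Φ ψ := by
  intro x
  refine ⟨hc.ambientAut_mem hsec, fun hx => ?_⟩
  have := (hc.symm hsec).ambientAut_mem hsec hx
  rwa [show 𝔉.ambientAut Φ.symm ψ.symm (𝔉.ambientAut Φ ψ x) = x from
    (𝔉.ambientAut Φ ψ).symm_apply_apply x] at this

end IsEnvCompatible

end Compatible

/-! ### Bookkeeping on `Out(E^Π_N)` -/

section OutLemmas

/-- `conjOut` is multiplicative. [cite: MochizukiEtTh2009, Lem 5.9 (iv) p.332 (PDF p.106)] -/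
theorem conjOut_mul (n m : Subgroup.normalizer (𝔉.EPiN : Set (Aut 𝔉.BN × 𝔉.PiX))) :
    𝔉.conjOut (n * m) = 𝔉.conjOut n * 𝔉.conjOut m := by
  change TopOut.mk _ _ = TopOut.mk _ _ * TopOut.mk _ _
  rw [← map_mul]
  congr 1
  exact Subtype.ext (map_mul 𝔉.EPiN.normalizerMonoidHom n m)

/-- `conjOut n` depends only on the underlying element. [cite: MochizukiEtTh2009, Lem 5.9 (iv) p.332 (PDF p.106)] -/
theorem conjOut_congr {n m : Subgroup.normalizer (𝔉.EPiN : Set (Aut 𝔉.BN × 𝔉.PiX))}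
    (h : (n : Aut 𝔉.BN × 𝔉.PiX) = m) : 𝔉.conjOut n = 𝔉.conjOut m :=
  congrArg 𝔉.conjOut (Subtype.ext h)

/-- Transport along `e` undoes transport along `e⁻¹` on `Out`.
[cite: MochizukiEtTh2009, Def 2.13 (ii) p.47] -/
theorem transport_transport_symm_apply {A B : Type*} [Group A] [Group B] [TopologicalSpace A]
    [TopologicalSpace B] (e : A ≃ₜ* B) (d : TopOut B) :
    TopOut.transport e (TopOut.transport e.symm d) = d := by
  induction d using QuotientGroup.induction_on with
  | H φ =>
    change TopOut.mk _ (conjContAut e (conjContAut e.symm φ)) = TopOut.mk _ φ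
    congr 1
    apply Subtype.ext
    apply MulEquiv.ext
    intro x
    change e (e.symm (φ.1 (e.symm.symm (e.symm x)))) = φ.1 x
    rw [ContinuousMulEquiv.apply_symm_apply, ContinuousMulEquiv.symm_symm,
      ContinuousMulEquiv.apply_symm_apply]

/-- `liftPi g = (s^⊓-gp_N(ρ g), g)`. [cite: MochizukiEtTh2009, Lem 5.9 (iii) p.332 (PDF p.106)] -/
theorem liftPi_apply (g : 𝔉.PiX) : 𝔉.liftPi g = (𝔉.sgpCap (𝔉.ρ g), g) := rfl

end OutLemmas

/-! ### `Inn(g)` on `Π^tp_X̲` and `Ψ^Aut` as automorphisms -/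

section PsiAut

/-- Conjugation by `g ∈ Π^tp_X̲` as an automorphism of the topological group `Π^tp_X̲` (the
"`Π^tp_X`-conjugacy" of p.334 (PDF p.108)).  [cite: MochizukiEtTh2009, Thm 5.10 (iii) p.334 (PDF p.108)] -/
def conjTop (g : 𝔉.PiX) : 𝔉.PiX ≃ₜ* 𝔉.PiX :=
  { MulAut.conj g with
    continuous_toFun := by
      change Continuous fun y => g * y * g⁻¹
      fun_prop
    continuous_invFun := by
      change Continuous fun y => g⁻¹ * y * g
      fun_prop }

/-- `conjTop g y = g · y · g⁻¹`. [cite: MochizukiEtTh2009, Thm 5.10 (iii) p.334 (PDF p.108)] -/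
@[simp] theorem conjTop_apply (g y : 𝔉.PiX) : 𝔉.conjTop g y = g * y * g⁻¹ := rfl

/-- `Ψ^Aut` ("the automorphism determined by applying `Ψ` followed by conjugation by `β`", p.333 (PDF p.107))
as a group automorphism of `Aut_C(B_N)` (`Ψ` is fully faithful).
[cite: MochizukiEtTh2009, Thm 5.10 (ii) p.333 (PDF p.107)] -/
noncomputable def psiAutEquiv (Ψ : C ≌ C) (β : Ψ.functor.obj 𝔉.BN ≅ 𝔉.BN) :
    Aut 𝔉.BN ≃* Aut 𝔉.BN :=
  (Ψ.fullyFaithfulFunctor.autMulEquivOfFullyFaithful 𝔉.BN).trans β.conjAut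

/-- `psiAutEquiv` is `psiAut`. [cite: MochizukiEtTh2009, Thm 5.10 (ii) p.333 (PDF p.107)] -/
@[simp] theorem psiAutEquiv_apply (Ψ : C ≌ C) (β : Ψ.functor.obj 𝔉.BN ≅ 𝔉.BN) (a : Aut 𝔉.BN) :
    𝔉.psiAutEquiv Ψ β a = 𝔉.psiAut Ψ β a := rfl

/-- `psiAutEquiv` and `psiAut` agree as homomorphisms. [cite: MochizukiEtTh2009, Thm 5.10 (ii) p.333 (PDF p.107)] -/
theorem psiAutEquiv_toMonoidHom (Ψ : C ≌ C) (β : Ψ.functor.obj 𝔉.BN ≅ 𝔉.BN) :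
    (𝔉.psiAutEquiv Ψ β).toMonoidHom = 𝔉.psiAut Ψ β :=
  MonoidHom.ext fun _ => rfl

end PsiAut

end ThetaFrobenioid

end Literature.AnabelianGeometry.EtaleTheta
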